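import Summits.QuantumFields.YangMills.Theses.FlatTubeReduction
import Summits.QuantumFields.YangMills.Theorems.FlatTubeReductionValleySplitDefs
import HarnessLib

/-!
# The retired glue statement `NearFlatSplitGlue` of route `FlatTubeReduction`, kept as a plain definition under its ORIGINAL name
# (item stmt-QuantumFields-24924, closed·proved by `Theorems.FlatTubeReduction.nearFlatSplitGlue_proof`; seat `ym-line-ftr-p1` g22, tree hygiene after
# route render f3821d4c; R2b1 RECORD rung — no summit statement is proved here)

Route render `f3821d4c` (2026-08-30T08:55Z, after K1 `NearFlatRatioLaw` stmt-QuantumFields-24720 closed·proved) could not keep the closed glue item's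
decl `Summit.QuantumFields.YangMills.Theses.FlatTubeReduction.NearFlatSplitGlue` («BLOCKED: missing decl(s) PinnedTubeRatioLaw,
ValleyRelocalisation» — its two hypotheses went closed·MOOT and were dropped), while the landed, append-only proof file
`Theorems/FlatTubeReductionNearFlatSplitGlue.lean` states `theorem nearFlatSplitGlue_proof : Summit.QuantumFields.YangMills.Theses.FlatTubeReduction.NearFlatSplitGlue`
BY THAT FULLY-QUALIFIED NAME (tribunal-ym J ADDENDUM-1; director-ym R557-ym (3)).  Since Theorems files are append-only (a landed theorem's statement may
not be mutated), the only repair on the prover side is to supply the name again: THIS FILE declares it, with the route's own body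
`PinnedTubeRatioLaw → ValleyRelocalisation → TubeMaximiser → NearFlatRatioLaw`, the two retired hypotheses being the verbatim plain definitions of
`Theorems/FlatTubeReductionValleySplitDefs.lean` and the two live decls being the route's.  DEFINITION ONLY (its proof is the unchanged
`nearFlatSplitGlue_proof`, whose module now imports this one).

MAINTENANCE NOTE: should a future render of `Theses/FlatTubeReduction.lean` declare `NearFlatSplitGlue` again, this file becomes redundant and must be
emptied (operator `--maintenance`) — it is imported only by `Theorems/FlatTubeReductionNearFlatSplitGlue.lean`.  `Theorems/FlatTubeReductionValleySplitDefs.lean`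
deliberately does NOT import the route file, so a route edit may import it without a cycle.
HONEST FRAMING: bookkeeping; fixed-lattice statements; not uniform in `L`, not infinite volume, not a mass gap, not Clay.
-/

set_option autoImplicit false

/-- **Glue statement of the valley split of K1** (retired route decl of the closed·proved item stmt-QuantumFields-24924, original name):
`PinnedTubeRatioLaw → ValleyRelocalisation → TubeMaximiser → NearFlatRatioLaw` — K1a and K1b (plain definitions, namespace
`Theorems.FlatTubeReduction`) together with the tube maximiser (route decl, proved: `tubeMaximiser_proof`) give the parent crux K1 (route decl,
proved: `nearFlatRatioLaw_proof`).  Definition only (route-posited statement, NOT a literature fact); proved by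
`Theorems.FlatTubeReduction.nearFlatSplitGlue_proof`. -/
def Summit.QuantumFields.YangMills.Theses.FlatTubeReduction.NearFlatSplitGlue : Prop :=
  Summit.QuantumFields.YangMills.Theorems.FlatTubeReduction.PinnedTubeRatioLaw →
    Summit.QuantumFields.YangMills.Theorems.FlatTubeReduction.ValleyRelocalisation →
      Summit.QuantumFields.YangMills.Theses.FlatTubeReduction.TubeMaximiser →
        Summit.QuantumFields.YangMills.Theses.FlatTubeReduction.NearFlatRatioLaw
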